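import Mathlib.Topology.Algebra.ContinuousMonoidHom
import Literature.NumberTheory.Automorphic.SmoothRepresentation
import HarnessLib

/-!
# Smooth vectors along an isomorphism of representations covering a bicontinuous group isomorphism

Topic `NumberTheory/Automorphic`; namespace `Literature.NumberTheory.Automorphic`.  THEOREMS ONLY (no definition, no instance, no notation,
no named fact, no `sorry`); pure representation theory over ★ `SmoothRepresentation` (`Representation.stabilizerSubgroup`,
`Representation.IsSmoothVector`, `Representation.smoothPart`).

THE POINT.  A linear isomorphism `U : V ≃ₗ V'` INTERTWINING two representations `ρ : H → GL(V)`, `ρ' : H' → GL(V')` ALONG a group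
isomorphism `θ : H ≃ H'` — `U (ρ h v) = ρ' (θ h) (U v)`, i.e. `ρ ≅ ρ' ∘ θ` — carries the stabiliser of `v` onto the stabiliser of `U v`
(`Stab(U v) = θ(Stab v)`); when `θ` is BICONTINUOUS (`H ≃ₜ* H'`) open stabilisers correspond, so `v` is smooth iff `U v` is, and
`U(V^∞) = V'^∞`.  This is the local-constituent hook of the transport of automorphic representations along an isomorphism of adelic
groups (sibling ★ `AutomorphicQuotientTransport`): restricting along compatible embeddings `ι : H →* G`, `ι' : H' →* G'`
(`e ∘ ι = ι' ∘ θ`, e.g. a local or the finite-adelic inclusion) an `e`-intertwiner is a `θ`-intertwiner of the restrictions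
(`semiconj_comp_of_semiconj`), whose smooth parts then correspond (`isSmoothVector_iff_of_semiconj`, `map_smoothPart_eq_of_semiconj`).
(Bernstein–Zelevinsky (1976) §2.1: smoothness is defined by open stabilisers, hence invariant under topological isomorphisms of the
group; Borel–Jacquet (1979) §4.6: local components of automorphic representations.)

## References
* [BernsteinZelevinsky1976] I. N. Bernstein, A. V. Zelevinsky, *Representations of the group GL(n, F) where F is a non-archimedean local
  field*, Russian Math. Surveys 31 (1976), §2.1.
* [BorelJacquet1979] A. Borel, H. Jacquet, *Automorphic forms and automorphic representations*, Proc. Sympos. Pure Math. 33 (1979),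
  part 1, §4.6.
-/

namespace Literature.NumberTheory.Automorphic

/-! ## Restriction along compatible embeddings; stabilisers and smooth vectors along a bicontinuous group isomorphism -/

section Hooks

variable {k H H' V V' : Type*} [CommRing k] [Group H] [Group H'] [AddCommGroup V] [Module k V] [AddCommGroup V'] [Module k V']

/-- **Restriction along compatible embeddings.**  If `U : V ≃ₗ V'` intertwines `ρ : G → GL(V)` and `ρ' : G' → GL(V')` along
`e : G ≃* G'` and `ι : H →* G`, `ι' : H' →* G'` are embeddings compatible with a group isomorphism `θ : H ≃* H'` (`e (ι h) = ι' (θ h)`),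
then `U` intertwines the restrictions `ρ ∘ ι` and `ρ' ∘ ι'` along `θ`.  (For `ι` = the finite-adelic or a local inclusion this is the
statement that local components are transported.) [cite: BorelJacquet1979, §4.6] -/
theorem semiconj_comp_of_semiconj {G G' : Type*} [Group G] [Group G'] (ρ : Representation k G V) (ρ' : Representation k G' V')
    (U : V ≃ₗ[k] V') (e : G ≃* G') (hU : ∀ g v, U (ρ g v) = ρ' (e g) (U v))
    (ι : H →* G) (ι' : H' →* G') (θ : H ≃* H') (hι : ∀ h, e (ι h) = ι' (θ h)) (h : H) (v : V) :
    U (ρ.comp ι h v) = ρ'.comp ι' (θ h) (U v) := by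
  rw [MonoidHom.comp_apply, MonoidHom.comp_apply, hU, hι]

variable [TopologicalSpace H] [TopologicalSpace H']

/-- The stabiliser of `U v` in `H'` is the `θ`-image (= `θ⁻¹`-preimage) of the stabiliser of `v` in `H`, for `U` intertwining along a
bicontinuous group isomorphism `θ`. [cite: BernsteinZelevinsky1976, §2.1] -/
theorem coe_stabilizerSubgroup_eq_preimage_of_semiconj (ρ : Representation k H V) (ρ' : Representation k H' V') (U : V ≃ₗ[k] V')
    (θ : H ≃ₜ* H') (hU : ∀ h v, U (ρ h v) = ρ' (θ h) (U v)) (v : V) :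
    (ρ'.stabilizerSubgroup (U v) : Set H') = θ.symm ⁻¹' (ρ.stabilizerSubgroup v : Set H) := by
  ext h'
  simp only [SetLike.mem_coe, Representation.mem_stabilizerSubgroup, Set.mem_preimage]
  constructor
  · intro hh
    apply U.injective
    rw [hU, ContinuousMulEquiv.apply_symm_apply, hh]
  · intro hh
    rw [← ContinuousMulEquiv.apply_symm_apply θ h', ← hU, hh]

/-- The stabiliser of `v` in `H` is the `θ`-preimage of the stabiliser of `U v` in `H'`. [cite: BernsteinZelevinsky1976, §2.1] -/
theorem coe_stabilizerSubgroup_eq_preimage_of_semiconj' (ρ : Representation k H V) (ρ' : Representation k H' V') (U : V ≃ₗ[k] V')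
    (θ : H ≃ₜ* H') (hU : ∀ h v, U (ρ h v) = ρ' (θ h) (U v)) (v : V) :
    (ρ.stabilizerSubgroup v : Set H) = θ ⁻¹' (ρ'.stabilizerSubgroup (U v) : Set H') := by
  ext h
  simp only [SetLike.mem_coe, Representation.mem_stabilizerSubgroup, Set.mem_preimage]
  rw [← hU, U.injective.eq_iff]

/-- **Smooth vectors correspond** under an isomorphism intertwining along a bicontinuous group isomorphism `θ : H ≃ₜ* H'`:
`U v` is smooth for `ρ'` iff `v` is smooth for `ρ` (the stabilisers correspond under `θ`). [cite: BorelJacquet1979, §4.6] -/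
theorem isSmoothVector_iff_of_semiconj (ρ : Representation k H V) (ρ' : Representation k H' V') (U : V ≃ₗ[k] V') (θ : H ≃ₜ* H')
    (hU : ∀ h v, U (ρ h v) = ρ' (θ h) (U v)) (v : V) : ρ'.IsSmoothVector (U v) ↔ ρ.IsSmoothVector v := by
  rw [Representation.isSmoothVector_iff, Representation.isSmoothVector_iff]
  constructor
  · intro hopen
    rw [coe_stabilizerSubgroup_eq_preimage_of_semiconj' ρ ρ' U θ hU v]
    exact hopen.preimage (map_continuous θ)
  · intro hopen
    rw [coe_stabilizerSubgroup_eq_preimage_of_semiconj ρ ρ' U θ hU v]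
    exact hopen.preimage (map_continuous θ.symm)

/-- **The smooth parts correspond**: `U(V^∞) = V'^∞` (as submodules) under an isomorphism intertwining along a homeomorphic group
isomorphism. [cite: BorelJacquet1979, §4.6] -/
theorem map_smoothPart_eq_of_semiconj [SeparatelyContinuousMul H] [SeparatelyContinuousMul H'] (ρ : Representation k H V)
    (ρ' : Representation k H' V') (U : V ≃ₗ[k] V') (θ : H ≃ₜ* H') (hU : ∀ h v, U (ρ h v) = ρ' (θ h) (U v)) :
    ρ.smoothPart.toSubmodule.map (U : V →ₗ[k] V') = ρ'.smoothPart.toSubmodule := by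
  ext v'
  constructor
  · rintro ⟨v, hv, rfl⟩
    exact (isSmoothVector_iff_of_semiconj ρ ρ' U θ hU v).2 hv
  · intro hv'
    refine ⟨U.symm v', ?_, U.apply_symm_apply v'⟩
    have h := (isSmoothVector_iff_of_semiconj ρ ρ' U θ hU (U.symm v')).1
    rw [U.apply_symm_apply] at h
    exact h hv'

end Hooks

end Literature.NumberTheory.Automorphic
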